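import Literature.AlgebraicGeometry.AbelianSchemes.SerreTensorHomModuleSource
import Literature.Algebra.Module.IdempotentMatrixDual
import HarnessLib

/-!
# ST-4 head: `Hom_𝒪(A₀ ⊗_𝒪 𝔟₀, A ⊗_𝒪 𝔟) ≅ (Hom_𝒪(A₀, A) ⊗_𝒪 𝔟₀^∨) ⊗_𝒪 𝔟`

Topic `AlgebraicGeometry/AbelianSchemes`, namespace `Literature.AlgebraicGeometry.AbelianSchemes.AbelianSchemeOver` (two constructions with bodies +
proved theorems; no named fact, no `sorry`, no `instance`, no notation; ANY base scheme `S`, any commutative `𝒪`).  Cell `hodgecm-mathlib`, F0/P6 «MOD»,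
organ **ST-4 (core) — the HEAD** of desk F0P6a-plan (g0) (ED3-CENSUS-P6a v1 §3∕§6 «`Hom_{𝒪_F}(A₀ ⊗ 𝔟₀, A ⊗ 𝔟) ≅ Hom_{𝒪_F}(A₀, A) ⊗ 𝔟₀⁻¹𝔟` as
hermitian `𝒪_F`-modules with level»; LEAD M-13 (1): the named lemma «CENTRAL» of `stub_RGD`∕`stub_HFROB` lives in ST-4∕ST-5): the plain `𝒪`-MODULE
isomorphism, composing ★ `SerreTensorHomModule` (p845207, target factor `⊗ 𝔟`), ★ `SerreTensorHomModuleSource` (p845243, source factor `⊗ 𝔟₀^∨`) and ★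
`Algebra/Module/IdempotentMatrixDual` (`Eᵀ·𝒪ⁿ ≅ (E·𝒪ⁿ)^∨`).  The HERMITIAN form (from the polarizations, RSZ §3.2) and the LEVEL clause are NOT in this
file (they wait for the polarization-currency word (D)); `--supports stmt-HodgeConjecture-24832`, count-neutral.  HC_CM is proved only modulo the 2
remaining named inputs (hLiu418, h413) until rung 0 closes; this file discharges none of them.

## Mathematics

For presentations `𝔟₀ = E₀·𝒪^{n₀}`, `𝔟 = E·𝒪ⁿ`:
`Hom_𝒪(A₀ ⊗ 𝔟₀, A ⊗ 𝔟) ≅ Hom_𝒪(A₀ ⊗ 𝔟₀, A) ⊗ 𝔟` (★ `serreHomTensorEquiv`, with `X := A₀ ⊗ 𝔟₀`)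
`≅ (Hom_𝒪(A₀, A) ⊗ E₀ᵀ·𝒪^{n₀}) ⊗ 𝔟` (★ `serreHomOutTensorEquiv`) `≅ (Hom_𝒪(A₀, A) ⊗ 𝔟₀^∨) ⊗ 𝔟` (★ `rangeTransposeEquivDual`).  For an invertible
ideal `𝔟₀` of a Dedekind ring, `𝔟₀^∨ = 𝔟₀⁻¹`, so the twisted Hom-module is `Hom_𝒪(A₀, A) ⊗ 𝔟₀⁻¹𝔟` ([RapoportSmithlingZhang2020Diagonal] §3.2: the
`Z^ℚ`-translation by `𝔟` on BOTH factors does not change the hermitian module; the central translate `⟨ϖ⟩` twists it by `𝔴𝔴̄⁻¹`).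

## Contents

* **`serreHomTwistEquiv`** : `homSubmodule (serreAction act₀ E₀ hE₀) (serreAction act E hE) ≃ₗ[O]
  (homSubmodule act₀ act ⊗[O] range (toLin' E₀ᵀ)) ⊗[O] range (toLin' E)`;
* **`serreHomTwistDualEquiv`** : `… ≃ₗ[O] (homSubmodule act₀ act ⊗[O] Module.Dual O (range (toLin' E₀))) ⊗[O] range (toLin' E)`;
* `serreHomTwistEquiv_eq_trans`, `serreHomTwistDualEquiv_eq_trans` (unfolding lemmas for consumers).

## References
* [RapoportSmithlingZhang2020Diagonal] M. Rapoport, B. Smithling, W. Zhang, *Arithmetic diagonal cycles on unitary Shimura varieties* (2020), §3.2.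
* [Conrad2004GrossZagier] B. Conrad, *Gross–Zagier revisited*, MSRI Publ. 49 (2004), §7 (Thm. 7.5).
* Tree: ★ `SerreTensorHomModule`, ★ `SerreTensorHomModuleSource`, ★ `Algebra/Module/IdempotentMatrixDual`.
-/

noncomputable section

universe u

open CategoryTheory CategoryTheory.Limits AlgebraicGeometry MonoidalCategory CartesianMonoidalCategory
open scoped MonObj TensorProduct

namespace Literature.AlgebraicGeometry.AbelianSchemes

namespace AbelianSchemeOver

open Literature.Algebra.Module.IdempotentMatrix RingAction

variable {S : Scheme.{u}} {A₀ A : AbelianSchemeOver S} {O : Type*} [CommRing O] (act₀ : A₀.RingAction O) (act : A.RingAction O)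
  [IsCommMonObj A₀.X] [IsCommMonObj A.X] {n₀ : ℕ} (E₀ : Matrix (Fin n₀) (Fin n₀) O) (hE₀ : E₀ * E₀ = E₀)
  {n : ℕ} (E : Matrix (Fin n) (Fin n) O) (hE : E * E = E)
  [IsCommMonObj (A₀.pow n₀).X] [IsCommMonObj (serreTensor act E hE).X]

/-- **ST-4 HEAD (presented form)**: `Hom_𝒪(A₀ ⊗_𝒪 𝔟₀, A ⊗_𝒪 𝔟) ≃ₗ[𝒪] (Hom_𝒪(A₀, A) ⊗_𝒪 Eᵀ₀·𝒪^{n₀}) ⊗_𝒪 E·𝒪ⁿ`.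
[cite: RapoportSmithlingZhang2020Diagonal, §3.2] [cite: Conrad2004GrossZagier, §7 (Thm. 7.5)] -/
def serreHomTwistEquiv :
    homSubmodule (serreAction act₀ E₀ hE₀) (serreAction act E hE) ≃ₗ[O]
      (homSubmodule act₀ act ⊗[O] LinearMap.range (Matrix.toLin' E₀.transpose)) ⊗[O] LinearMap.range (Matrix.toLin' E) :=
  (serreHomTensorEquiv (serreAction act₀ E₀ hE₀) act E hE).trans
    (TensorProduct.congr (serreHomOutTensorEquiv act₀ act E₀ hE₀) (LinearEquiv.refl O _))

/-- Unfolding: the head is ★ `serreHomTensorEquiv` followed by ★ `serreHomOutTensorEquiv ⊗ 1`. [cite: Conrad2004GrossZagier, §7 (Thm. 7.5)] -/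
theorem serreHomTwistEquiv_eq_trans :
    serreHomTwistEquiv act₀ act E₀ hE₀ E hE =
      (serreHomTensorEquiv (serreAction act₀ E₀ hE₀) act E hE).trans
        (TensorProduct.congr (serreHomOutTensorEquiv act₀ act E₀ hE₀) (LinearEquiv.refl O _)) := rfl

/-- **ST-4 HEAD (dual form)**: `Hom_𝒪(A₀ ⊗_𝒪 𝔟₀, A ⊗_𝒪 𝔟) ≃ₗ[𝒪] (Hom_𝒪(A₀, A) ⊗_𝒪 𝔟₀^∨) ⊗_𝒪 𝔟` with `𝔟₀^∨ = Hom_𝒪(𝔟₀, 𝒪)` (`= 𝔟₀⁻¹` for an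
invertible ideal) and `𝔟 = E·𝒪ⁿ`. [cite: RapoportSmithlingZhang2020Diagonal, §3.2] [cite: Conrad2004GrossZagier, §7 (Thm. 7.5)] -/
def serreHomTwistDualEquiv :
    homSubmodule (serreAction act₀ E₀ hE₀) (serreAction act E hE) ≃ₗ[O]
      (homSubmodule act₀ act ⊗[O] Module.Dual O (LinearMap.range (Matrix.toLin' E₀))) ⊗[O] LinearMap.range (Matrix.toLin' E) :=
  (serreHomTwistEquiv act₀ act E₀ hE₀ E hE).trans
    (TensorProduct.congr (TensorProduct.congr (LinearEquiv.refl O _) (rangeTransposeEquivDual E₀ hE₀)) (LinearEquiv.refl O _))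

/-- Unfolding of the dual form. [cite: Conrad2004GrossZagier, §7 (Thm. 7.5)] -/
theorem serreHomTwistDualEquiv_eq_trans :
    serreHomTwistDualEquiv act₀ act E₀ hE₀ E hE =
      (serreHomTwistEquiv act₀ act E₀ hE₀ E hE).trans
        (TensorProduct.congr (TensorProduct.congr (LinearEquiv.refl O _) (rangeTransposeEquivDual E₀ hE₀)) (LinearEquiv.refl O _)) := rfl

end AbelianSchemeOver

end Literature.AlgebraicGeometry.AbelianSchemes

end
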